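import Mathlib
import HarnessLib
import Literature.Probability.LatticeModels.LatticeGraph

/-!
# BalabanIR engine `BirComplexStableXY` (stmt-HubbardSuperconductivity-2080): connectivity of the
space-time torus and the coercive comparison

Support lemmas for crux 2 of route BalabanIR (`--supports stmt-HubbardSuperconductivity-2080`),
typed part of the fixed-volume Laplace analysis (companion of
`BalabanIRBirComplexStableXYFixedVolumeAction.lean`).  On `Λ = TorusSite 2 L × ZMod M`:

* `birLat_const_of_steps`: a function invariant under the three unit steps
  `E₁ = (![1,0],0)`, `E₂ = (![0,1],0)`, `E₃ = (0,1)` is constant (every site is a sum of unit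
  steps, `birLat_decompose`);
* `birLat_eq_zero_of_cos` / `birLat_eq_zero_of_diff`: with one spin fixed at `0` and all other
  angles in `[-π, π]`, `cos (θ_s − θ_{s+E_d}) = 1` along all unit steps forces `θ = 0`
  (resp. `θ_s = θ_{s+E_d}` forces `θ = 0`);
* `birLat_coercive_compare`: hypothesis (C) of the item (coercivity of `Re F` on the window,
  `r ≥ 2`) gives `c₀ Σ_s Σ_d (1 − cos (θ_s − θ_{s+E_d})) ≤ Re Σ_s F (θ ∘ sh s)`;
* `birLat_O_le_one`, `birLat_O_nonneg`, `birLat_O_zero`: the slice observable lies in `[0,1]`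
  and equals `1` at the aligned configuration.

No definitions.
-/

namespace Summit.HubbardSuperconductivity.HubbardSuperconductivity.Theorems

open scoped BigOperators
open MeasureTheory Set Complex Literature.Probability.LatticeModels

section Lattice

variable {L M : ℕ} [NeZero L] [NeZero M]

omit [NeZero L] [NeZero M] in
/-- Invariance under one step gives invariance under any number of steps. -/
theorem birLat_invariant_nsmul {X : Type*} (u : (TorusSite 2 L × ZMod M) → X)
    (v : TorusSite 2 L × ZMod M) (h : ∀ s, u (s + v) = u s) (n : ℕ) (s : TorusSite 2 L × ZMod M) :
    u (s + n • v) = u s := by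
  induction n with
  | zero => simp
  | succ n ih => rw [succ_nsmul, ← add_assoc, h, ih]

/-- Every site is a sum of unit steps. -/
theorem birLat_decompose (s : TorusSite 2 L × ZMod M) :
    s = (0 : TorusSite 2 L × ZMod M)
        + (s.1 0).val • ((![1, 0] : TorusSite 2 L), (0 : ZMod M))
        + (s.1 1).val • ((![0, 1] : TorusSite 2 L), (0 : ZMod M))
        + (s.2).val • ((0 : TorusSite 2 L), (1 : ZMod M)) := by
  refine Prod.ext ?_ ?_
  · funext i
    fin_cases i <;> simp [Prod.smul_mk]
  · simp [Prod.smul_mk]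

/-- **Connectivity.** A function on the space-time torus invariant under the three unit steps
is constant. -/
theorem birLat_const_of_steps {X : Type*} (u : (TorusSite 2 L × ZMod M) → X)
    (h₁ : ∀ s, u (s + (![1, 0], 0)) = u s) (h₂ : ∀ s, u (s + (![0, 1], 0)) = u s)
    (h₃ : ∀ s, u (s + (0, 1)) = u s) (s : TorusSite 2 L × ZMod M) : u s = u 0 := by
  rw [birLat_decompose s, birLat_invariant_nsmul u _ h₃, birLat_invariant_nsmul u _ h₂,
    birLat_invariant_nsmul u _ h₁]

/-- With the spin at `s₀` fixed to `0` and the other angles in `[-π, π]`: if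
`cos (θ_s − θ_{s+E_d}) = 1` along every unit step then `θ = 0`. -/
theorem birLat_eq_zero_of_cos (s₀ : TorusSite 2 L × ZMod M) (δ : {i // i ≠ s₀} → ℝ)
    (hδ : ∀ j, |δ j| ≤ Real.pi)
    (hcos : ∀ (s : TorusSite 2 L × ZMod M) (v : TorusSite 2 L × ZMod M),
      v ∈ ({(![1, 0], 0), (![0, 1], 0), (0, 1)} : Set (TorusSite 2 L × ZMod M)) →
      Real.cos ((fun i => if h : i = s₀ then (0 : ℝ) else δ ⟨i, h⟩) s
        - (fun i => if h : i = s₀ then (0 : ℝ) else δ ⟨i, h⟩) (s + v)) = 1) :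
    δ = 0 := by
  set ext : (TorusSite 2 L × ZMod M) → ℝ := fun i => if h : i = s₀ then (0 : ℝ) else δ ⟨i, h⟩
    with hext
  set u : (TorusSite 2 L × ZMod M) → ℂ := fun i => cexp (I * ext i) with hu
  have hstep : ∀ v ∈ ({(![1, 0], 0), (![0, 1], 0), (0, 1)} : Set (TorusSite 2 L × ZMod M)),
      ∀ s, u (s + v) = u s := by
    intro v hv s
    obtain ⟨n, hn⟩ := (Real.cos_eq_one_iff _).1 (hcos s v hv)
    have : ext s = ext (s + v) + n * (2 * Real.pi) := by linarith
    simp only [hu]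
    rw [this]
    push_cast
    rw [mul_add, Complex.exp_add]
    have h1 : cexp (I * ((n : ℂ) * (2 * Real.pi))) = 1 := by
      rw [← Complex.exp_int_mul_two_pi_mul_I n]; congr 1; ring
    rw [h1, mul_one]
  have hconst : ∀ s, u s = u 0 :=
    birLat_const_of_steps u (hstep _ (by simp)) (hstep _ (by simp)) (hstep _ (by simp))
  have hu0 : u s₀ = 1 := by simp [hu, hext]
  funext j
  have hj : u j.1 = 1 := by rw [hconst j.1, ← hconst s₀, hu0]
  have hj' : cexp (I * δ j) = 1 := by
    have : ext j.1 = δ j := by simp [hext, j.2]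
    simpa [hu, this] using hj
  obtain ⟨n, hn⟩ := Complex.exp_eq_one_iff.1 hj'
  have hδn : δ j = n * (2 * Real.pi) := by
    have h2 : I * (δ j : ℂ) = I * ((n * (2 * Real.pi) : ℝ) : ℂ) := by
      rw [hn]; push_cast; ring
    have h3 := mul_left_cancel₀ Complex.I_ne_zero h2
    exact_mod_cast h3
  have habs := hδ j
  rw [hδn, abs_mul, abs_of_pos Real.two_pi_pos] at habs
  have hn0 : (n : ℝ) = 0 := by
    by_contra hne
    have h1 : (1 : ℝ) ≤ |(n : ℝ)| := by
      rw [← Int.cast_abs]; exact_mod_cast Int.one_le_abs (by exact_mod_cast hne)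
    nlinarith [Real.pi_pos]
  rw [Pi.zero_apply, hδn, hn0, zero_mul]

/-- With the spin at `s₀` fixed to `0`: if `θ_s = θ_{s+E_d}` along every unit step then
`θ = 0`. -/
theorem birLat_eq_zero_of_diff (s₀ : TorusSite 2 L × ZMod M) (δ : {i // i ≠ s₀} → ℝ)
    (hdiff : ∀ (s : TorusSite 2 L × ZMod M) (v : TorusSite 2 L × ZMod M),
      v ∈ ({(![1, 0], 0), (![0, 1], 0), (0, 1)} : Set (TorusSite 2 L × ZMod M)) →
      (fun i => if h : i = s₀ then (0 : ℝ) else δ ⟨i, h⟩) s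
        - (fun i => if h : i = s₀ then (0 : ℝ) else δ ⟨i, h⟩) (s + v) = 0) :
    δ = 0 := by
  set ext : (TorusSite 2 L × ZMod M) → ℝ := fun i => if h : i = s₀ then (0 : ℝ) else δ ⟨i, h⟩
    with hext
  have hstep : ∀ v ∈ ({(![1, 0], 0), (![0, 1], 0), (0, 1)} : Set (TorusSite 2 L × ZMod M)),
      ∀ s, ext (s + v) = ext s := fun v hv s => by linarith [hdiff s v hv]
  have hconst : ∀ s, ext s = ext 0 :=
    birLat_const_of_steps ext (hstep _ (by simp)) (hstep _ (by simp)) (hstep _ (by simp))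
  have h0 : ext s₀ = 0 := by simp [hext]
  funext j
  have : ext j.1 = δ j := by simp [hext, j.2]
  rw [Pi.zero_apply, ← this, hconst j.1, ← hconst s₀, h0]

end Lattice

section Compare

variable {r : ℕ} {L M : ℕ} [NeZero L] [NeZero M]

omit [NeZero L] [NeZero M] in
/-- The three unit window vectors `(1,0,0)`, `(0,1,0)`, `(0,0,1)` and the origin of the window,
for `r ≥ 2`, are mapped by the window shift to `s + E₁`, `s + E₂`, `s + E₃` and `s`. -/
theorem birLat_sh_unit (hr : 2 ≤ r)
    {sh : (TorusSite 2 L × ZMod M) → (Fin r × Fin r × Fin r) → (TorusSite 2 L × ZMod M)}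
    (hsh : ∀ s w, sh s w = (s.1 + ![((w.1 : ℕ) : ZMod L), ((w.2.1 : ℕ) : ZMod L)],
      s.2 + ((w.2.2 : ℕ) : ZMod M)))
    (s : TorusSite 2 L × ZMod M) :
    sh s (⟨0, by omega⟩, ⟨0, by omega⟩, ⟨0, by omega⟩) = s ∧
    sh s (⟨1, by omega⟩, ⟨0, by omega⟩, ⟨0, by omega⟩) = s + (![1, 0], 0) ∧
    sh s (⟨0, by omega⟩, ⟨1, by omega⟩, ⟨0, by omega⟩) = s + (![0, 1], 0) ∧
    sh s (⟨0, by omega⟩, ⟨0, by omega⟩, ⟨1, by omega⟩) = s + (0, 1) := by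
  refine ⟨?_, ?_, ?_, ?_⟩ <;> rw [hsh] <;> refine Prod.ext ?_ ?_ <;>
    simp <;> (try (funext i; fin_cases i <;> simp [Matrix.vecHead, Matrix.vecTail]))

/-- **Coercive comparison.**  Under hypothesis (C) of the item (`r ≥ 2`), the real part of the
summed window action dominates `c₀` times the nearest-neighbour XY energy along the three unit
steps of the space-time torus. -/
theorem birLat_coercive_compare (hr : 2 ≤ r)
    {c₀ : ℝ} {F : ((Fin r × Fin r × Fin r) → ℝ) → ℂ}
    (hC : ∀ φ : (Fin r × Fin r × Fin r) → ℝ,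
      c₀ * ∑ w, ∑ w', (1 - Real.cos (φ w - φ w')) ≤ (F φ).re)
    {sh : (TorusSite 2 L × ZMod M) → (Fin r × Fin r × Fin r) → (TorusSite 2 L × ZMod M)}
    (hsh : ∀ s w, sh s w = (s.1 + ![((w.1 : ℕ) : ZMod L), ((w.2.1 : ℕ) : ZMod L)],
      s.2 + ((w.2.2 : ℕ) : ZMod M)))
    (hc₀ : 0 ≤ c₀) (θ : (TorusSite 2 L × ZMod M) → ℝ) :
    c₀ * ∑ s : TorusSite 2 L × ZMod M,
        ((1 - Real.cos (θ s - θ (s + (![1, 0], 0)))) + (1 - Real.cos (θ s - θ (s + (![0, 1], 0))))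
          + (1 - Real.cos (θ s - θ (s + (0, 1)))))
      ≤ (∑ s, F (fun w => θ (sh s w))).re := by
  set w₀ : Fin r × Fin r × Fin r := (⟨0, by omega⟩, ⟨0, by omega⟩, ⟨0, by omega⟩) with hw₀
  set e₁ : Fin r × Fin r × Fin r := (⟨1, by omega⟩, ⟨0, by omega⟩, ⟨0, by omega⟩) with he₁
  set e₂ : Fin r × Fin r × Fin r := (⟨0, by omega⟩, ⟨1, by omega⟩, ⟨0, by omega⟩) with he₂
  set e₃ : Fin r × Fin r × Fin r := (⟨0, by omega⟩, ⟨0, by omega⟩, ⟨1, by omega⟩) with he₃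
  have h12 : e₁ ≠ e₂ := by simp [he₁, he₂, Fin.ext_iff]
  have h13 : e₁ ≠ e₃ := by simp [he₁, he₃, Fin.ext_iff]
  have h23 : e₂ ≠ e₃ := by simp [he₂, he₃, Fin.ext_iff]
  rw [Complex.re_sum, Finset.mul_sum]
  refine Finset.sum_le_sum fun s _ => ?_
  obtain ⟨hs0, hs1, hs2, hs3⟩ := birLat_sh_unit hr hsh s
  refine le_trans ?_ (hC (fun w => θ (sh s w)))
  refine mul_le_mul_of_nonneg_left ?_ hc₀
  -- the double window sum dominates the three unit-step terms
  set T : (Fin r × Fin r × Fin r) → (Fin r × Fin r × Fin r) → ℝ :=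
    fun w w' => 1 - Real.cos (θ (sh s w) - θ (sh s w')) with hT
  have hT0 : ∀ w w', 0 ≤ T w w' := fun w w' => by
    simp only [hT]; linarith [Real.cos_le_one (θ (sh s w) - θ (sh s w'))]
  have h1 : ∑ w' ∈ ({e₁, e₂, e₃} : Finset (Fin r × Fin r × Fin r)), T w₀ w' ≤ ∑ w', T w₀ w' :=
    Finset.sum_le_sum_of_subset_of_nonneg (Finset.subset_univ _) fun w' _ _ => hT0 w₀ w'
  have h2 : ∑ w', T w₀ w' ≤ ∑ w, ∑ w', T w w' :=
    Finset.single_le_sum (f := fun w => ∑ w', T w w')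
      (fun w _ => Finset.sum_nonneg fun w' _ => hT0 w w') (Finset.mem_univ w₀)
  have h3 : ∑ w' ∈ ({e₁, e₂, e₃} : Finset (Fin r × Fin r × Fin r)), T w₀ w'
      = T w₀ e₁ + T w₀ e₂ + T w₀ e₃ := by
    rw [Finset.sum_insert (by simp [h12, h13]), Finset.sum_pair h23, add_assoc]
  have h4 : T w₀ e₁ + T w₀ e₂ + T w₀ e₃
      = (1 - Real.cos (θ s - θ (s + (![1, 0], 0)))) + (1 - Real.cos (θ s - θ (s + (![0, 1], 0))))
          + (1 - Real.cos (θ s - θ (s + (0, 1)))) := by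
    simp only [hT, hw₀, he₁, he₂, he₃, hs0, hs1, hs2, hs3]
  linarith

end Compare

section ObservableBounds

variable {L M : ℕ} [NeZero L]

/-- The number of sites of a time slice is `L²`. -/
theorem birLat_card_slice : Fintype.card (TorusSite 2 L) = L ^ 2 := by
  rw [Fintype.card_fun, ZMod.card, Fintype.card_fin]

/-- The slice observable is at most `1`. -/
theorem birLat_O_le_one {O : ((TorusSite 2 L × ZMod M) → ℝ) → ℝ}
    (hO : ∀ θ, O θ = ‖∑ x : TorusSite 2 L, cexp (I * (θ (x, 0) : ℂ))‖ ^ 2 / (L : ℝ) ^ 4)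
    (θ : (TorusSite 2 L × ZMod M) → ℝ) : O θ ≤ 1 := by
  rw [hO]
  have hL : (0 : ℝ) < L := by exact_mod_cast Nat.pos_of_ne_zero (NeZero.ne L)
  have hnorm : ‖∑ x : TorusSite 2 L, cexp (I * (θ (x, 0) : ℂ))‖ ≤ (L : ℝ) ^ 2 := by
    calc ‖∑ x : TorusSite 2 L, cexp (I * (θ (x, 0) : ℂ))‖
        ≤ ∑ x : TorusSite 2 L, ‖cexp (I * (θ (x, 0) : ℂ))‖ := norm_sum_le _ _
      _ = ∑ _x : TorusSite 2 L, (1 : ℝ) := by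
          refine Finset.sum_congr rfl fun x _ => ?_
          rw [mul_comm, Complex.norm_exp_ofReal_mul_I]
      _ = (L : ℝ) ^ 2 := by
          rw [Finset.sum_const, Finset.card_univ, birLat_card_slice]; simp
  have h4 : (L : ℝ) ^ 4 = ((L : ℝ) ^ 2) ^ 2 := by ring
  rw [div_le_one (by positivity), h4]
  exact pow_le_pow_left₀ (norm_nonneg _) hnorm 2

/-- The slice observable is non-negative. -/
theorem birLat_O_nonneg {O : ((TorusSite 2 L × ZMod M) → ℝ) → ℝ}
    (hO : ∀ θ, O θ = ‖∑ x : TorusSite 2 L, cexp (I * (θ (x, 0) : ℂ))‖ ^ 2 / (L : ℝ) ^ 4)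
    (θ : (TorusSite 2 L × ZMod M) → ℝ) : 0 ≤ O θ := by
  rw [hO]; positivity

/-- At the aligned configuration the slice observable equals `1`. -/
theorem birLat_O_zero {O : ((TorusSite 2 L × ZMod M) → ℝ) → ℝ}
    (hO : ∀ θ, O θ = ‖∑ x : TorusSite 2 L, cexp (I * (θ (x, 0) : ℂ))‖ ^ 2 / (L : ℝ) ^ 4) :
    O (fun _ => 0) = 1 := by
  rw [hO]
  have hL : (0 : ℝ) < L := by exact_mod_cast Nat.pos_of_ne_zero (NeZero.ne L)
  simp only [Complex.ofReal_zero, mul_zero, Complex.exp_zero, Finset.sum_const, Finset.card_univ,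
    birLat_card_slice, nsmul_eq_mul, mul_one]
  push_cast
  rw [norm_pow, Complex.norm_natCast]
  field_simp

end ObservableBounds

end Summit.HubbardSuperconductivity.HubbardSuperconductivity.Theorems
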